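import Summits.Ventures.YMGap.RobustBall.HeatBathPoincare
import Summits.Ventures.YMGap.RobustBall.TorusDoor
import HarnessLib

/-!
# Robust ball (Y2) — THE HEAT-BATH POINCARÉ INEQUALITY (GLAUBER SPECTRAL GAP) UNIFORMLY ON THE TORUS BALL AND IN THE VOLUME

HONEST FRAMING: venture file of the cell `pub-ymgap` (QuantumFields programme), track ROBUST-BALL, seat rb-p2 (g13).  LATTICE statements at STRONG
COUPLING for the torus measures `μ_{β,W,L} = Z⁻¹ e^{−β S_W − W} ∏ dU_e` of the MEMBERS `W` of the cell's ball of perturbed `SU(N)` lattice gauge actions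
(`Perturbation d L N`, per-link LOADS of a `LoadWitness`: oscillation `a(e)`, self-Lipschitz `ℓ_s(e)`, cross-Lipschitz `ℓ(e,y)`), on `(ℤ/L)^d`, `L ≥ 2`,
with constants independent of `L` and of the member; nothing about `β → ∞`, the continuum or Clay.  BALL-UNIFORM (not Wilson in disguise): the
member's OWN measure and OWN heat baths appear; at `W = 0` the statement is the cell's Wilson theorem `HeatBathPoincare.heatBathPoincare_of_oneLinkKRModulus`.

THE STATEMENT (`heatBathPoincare_onBall`): `d ≥ 1`, tree coupling `β` with `(|β|/N)·2(d−1) ≤ R`, `OneLinkKRModulus N R K`; a member `W` with a load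
witness `w` such that at EVERY link `a(e) ≤ ε₀`, `ℓ_s(e) ≤ ε₁` and — the one load the spectral gap needs beyond the clustering rows — the COLUMN
cross-Lipschitz load `∑_{e ≠ y} ℓ(e,y) ≤ ε₂` at every link `y` (for plaquette-type members `ℓ(e,y)` is symmetric and this is the row load `Λ ≤ ε₁`);
if `c := K e^{ε₀}(1 + 2√N ε₁)(|β|/N)·6(d−1) + √N ε₂ < 1` then for every torus side `L ≥ 2` and every bounded measurable `F`,
`Var_{μ_{β,W,L}}(F) ≤ (2(1 − c))⁻¹ ∑_ℓ ∫∫ (F(U) − F(U[ℓ ↦ g]))² dν^{W}_ℓ(g | U) dμ_{β,W,L}(U)`, `ν^W_ℓ(· | U) = Haar.tilted(−β S_W(U[ℓ ↦ ·]) − W(U[ℓ ↦ ·]))`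
the member's one-link heat bath: the random-scan heat-bath (Glauber) dynamics of EVERY member has spectral gap `≥ 1 − c` on every torus.
★★ `su2_heatBathPoincare_onBall`: `SU(2)`, `d = 4`, quarter modulus, `c = (9β_W/2) e^{ε₀}(1 + 2√2 ε₁) + √2 ε₂`; ★★ `su2_heatBathPoincare_onBall_oneEighth`:
loads `(ε₀, ε₁, ε₂) = (1/100, 1/500, 1/500)` (the sprint ball's per-link loads), EVERY `0 ≤ β_W ≤ 1/8`: constant `5/4`, gap `≥ 2/5`, every member, every torus.
MECHANISM: the YangMills summit's abstract engine `StrongPinningPoincare.HeatBath.variance_le_of_kr` (Wu 2006: one-site Kantorovich condition with COLUMN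
sums `≤ c` ⇒ heat-bath Poincaré `(2(1 − c))⁻¹`) on the member's measure (`perturbedMeasure_eq_tilted`: a tilted product Haar measure) fed with the
cell's ROBUST DOBRUSHIN ENTRY `TorusDoor.abs_integral_siteLaw_sub_le` (`|γ^W_e(φ|ω) − γ^W_e(φ|η)| ≤ (K e^{a(e)}(1 + 2√N ℓ_s(e))(|β|/N) n(e,y) + √N ℓ(e,y))
Lφ ‖ω_y − η_y‖_F`), the one-link law `siteLaw_perturbedTorusSpec_eq_tilted_haar`, and the symmetric count `n(e,y) ≤ k(e,y)`, `∑_{e≠y} k(e,y) ≤ 6(d−1)`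
(`HeatBathPoincare.tInfluence_le_jointPlaq`, `sum_erase_jointPlaq_le`).  0 sorry, 0 definitions.
References: L. Wu, Ann. Probab. 34 (2006) 1960; Y. Ollivier, JFA 256 (2009) 810; H. Shen, R. Zhu, X. Zhu, CMP 400 (2023) 805.  Everything here is proved.
[folklore]
-/

noncomputable section

open MeasureTheory ProbabilityTheory Finset Function Real
open Literature.Probability.LatticeModels Literature.Probability.LatticeModels.DobrushinMetric
open Literature.MathematicalPhysics.QuantumLattice hiding torusNorm
open Literature.MathematicalPhysics.QuantumFieldTheory hiding ZdEdge
open Literature.MathematicalPhysics.QuantumFieldTheory.Balaban1983to89.StrongCouplingTorusWindow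
open Literature.MathematicalPhysics.QuantumFieldTheory.Balaban1983to89.StrongCouplingDobrushinWindow (OneLinkKRModulus)
open Summit.QuantumFields.YangMills.Theorems.StrongPinningPoincare
open Summit.Ventures.YMGap.RobustBall.HeatBathPoincare (tInfluence_le_jointPlaq sum_erase_jointPlaq_le)

namespace Summit.Ventures.YMGap.RobustBall.HeatBathPoincareBall

variable {d L N : ℕ} [NeZero L]

/-- ★★★ **THE HEAT-BATH POINCARÉ INEQUALITY UNIFORMLY ON THE TORUS BALL AND IN THE VOLUME** (`d ≥ 1`, tree coupling `β`, torus side `L ≥ 2`): for a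
member `W` with a load witness of per-link oscillation load `≤ ε₀`, self-Lipschitz load `≤ ε₁` and COLUMN cross-Lipschitz load `≤ ε₂`, a modulus
`OneLinkKRModulus N R K` on `R ≥ (|β|/N) 2(d−1)` and `c := K e^{ε₀}(1 + 2√N ε₁)(|β|/N) 6(d−1) + √N ε₂ < 1`, every bounded measurable `F` has
`Var_{μ_{β,W,L}}(F) ≤ (2(1 − c))⁻¹ ∑_ℓ ∫∫ (F(U) − F(U[ℓ ↦ g]))² dν^W_ℓ(g | U) dμ_{β,W,L}(U)` — the member's heat-bath dynamics has spectral gap `≥ 1 − c`.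
[folklore] -/
theorem heatBathPoincare_onBall (hd : 1 ≤ d) (hN : 1 ≤ N) (hL : 1 < L) {β R K : ℝ} (hK : 0 ≤ K)
    (hR : |β| / N * (2 * ((d : ℝ) - 1)) ≤ R) (hmod : OneLinkKRModulus N R K) {W : Perturbation d L N} (w : LoadWitness W)
    {ε₀ ε₁ ε₂ c : ℝ} (ha : ∀ e, w.oscLoad 0 e ≤ ε₀) (hs : ∀ e, w.selfLipLoad 0 e ≤ ε₁)
    (hcol : ∀ y, ∑ e ∈ univ.erase y, w.crossLip 0 e y ≤ ε₂)
    (hc : K * Real.exp ε₀ * (1 + 2 * Real.sqrt N * ε₁) * (|β| / N) * (6 * (d - 1 : ℕ)) + Real.sqrt N * ε₂ ≤ c) (hc1 : c < 1)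
    (F : GaugeConfig d L (SUN N) → ℝ) (hF : Measurable F) (hFb : ∃ M : ℝ, ∀ U, |F U| ≤ M) :
    variance F (W.perturbedMeasure (fundamentalRep (Fin N)) β) ≤
      (2 * (1 - c))⁻¹ * ∑ ℓ : Edge d L, ∫ U, ∫ g, (F U - F (update U ℓ g)) ^ 2
        ∂((haarProbability (SUN N)).tilted fun g' =>
            torusLogWeight (wilsonPlaqWeight N β) (update U ℓ g') - W.total (update U ℓ g'))
        ∂(W.perturbedMeasure (fundamentalRep (Fin N)) β) := by
  classical
  obtain ⟨M, hM⟩ := hFb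
  have hN0 : (0 : ℝ) < N := by exact_mod_cast (show 0 < N by omega)
  let e₀ : Edge d L := (fun _ => 0, ⟨0, hd⟩)
  haveI : Nonempty (Edge d L) := ⟨e₀⟩
  -- the member's log-density `V = −β S_W − W`
  set V : GaugeConfig d L (SUN N) → ℝ := fun U => torusLogWeight (wilsonPlaqWeight N β) U - W.total U with hV
  have hVm : Measurable V := measurable_perturbedTorusEnergy W β
  obtain ⟨B₁, hB₁⟩ := exists_abs_perturbedTorusEnergy_le W β
  -- the Frobenius distance on `SU(N)`
  have hdc : Continuous fun p : SUN N × SUN N => suFrobDist p.1 p.2 :=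
    Lattice.continuous_frobNorm.comp ((continuous_subtype_val.comp continuous_fst).sub (continuous_subtype_val.comp continuous_snd))
  have hdsep : ∀ e e' : SUN N, suFrobDist e e' = 0 → e = e' := fun e e' h =>
    Subtype.ext (sub_eq_zero.1 (Lattice.eq_zero_of_frobNorm_eq_zero h))
  have hdtri : ∀ a b c' : SUN N, suFrobDist a c' ≤ suFrobDist a b + suFrobDist b c' := fun a b c' => frobNorm_sub_le _ _ _
  -- the dominating (column-summable) influence matrix
  set A : ℝ := K * Real.exp ε₀ * (1 + 2 * Real.sqrt N * ε₁) * (|β| / N) with hA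
  have hε₁ : 0 ≤ ε₁ := le_trans (selfLipLoad_nonneg w 0 e₀) (hs e₀)
  have hA0 : 0 ≤ A := by positivity
  set cm : Edge d L → Edge d L → ℝ := fun i j => A * jointPlaq i j + Real.sqrt N * w.crossLip 0 i j with hcm
  have hκ₀ : 0 < 1 - c := by linarith
  have hcsum : ∀ j, ∑ i ∈ univ.erase j, cm i j ≤ 1 - (1 - c) := fun j => by
    simp only [hcm]
    rw [Finset.sum_add_distrib, ← Finset.mul_sum, ← Finset.mul_sum, sub_sub_cancel]
    calc A * ∑ i ∈ univ.erase j, (jointPlaq i j : ℝ) + Real.sqrt N * ∑ i ∈ univ.erase j, w.crossLip 0 i j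
        ≤ A * (6 * (d - 1 : ℕ)) + Real.sqrt N * ε₂ :=
          add_le_add (mul_le_mul_of_nonneg_left (sum_erase_jointPlaq_le j) hA0) (mul_le_mul_of_nonneg_left (hcol j) (Real.sqrt_nonneg _))
      _ ≤ c := by rw [hA]; exact hc
  have hc0 : 0 ≤ c := by
    have h := hcsum e₀
    rw [sub_sub_cancel] at h
    exact le_trans (Finset.sum_nonneg fun i _ => add_nonneg (mul_nonneg hA0 (Nat.cast_nonneg _))
      (mul_nonneg (Real.sqrt_nonneg _) (crossLip_nonneg w 0 _ _))) h
  -- the one-site Kantorovich–Rubinstein condition: the cell's robust Dobrushin entry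
  have hKR : ∀ (i j : Edge d L), i ≠ j → ∀ (x : GaugeConfig d L (SUN N)) (a : SUN N) (ψ : SUN N → ℝ) (Lψ Mψ : ℝ), Measurable ψ →
      (∀ e, |ψ e| ≤ Mψ) → 0 ≤ Lψ → (∀ e e', |ψ e - ψ e'| ≤ Lψ * suFrobDist e e') →
      |∫ e, ψ e ∂((haarProbability (SUN N)).tilted fun e => V (update x i e)) -
        ∫ e, ψ e ∂((haarProbability (SUN N)).tilted fun e => V (update (update x j a) i e))| ≤ Lψ * cm i j * suFrobDist (x j) a := by
    intro i j hij x a ψ Lψ Mψ hψm hψb hL0 hψL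
    have e1 : ((haarProbability (SUN N)).tilted fun e => V (update x i e)) = siteLaw (perturbedTorusSpec W β) i x :=
      (siteLaw_perturbedTorusSpec_eq_tilted_haar W β i x).symm
    have e2 : ((haarProbability (SUN N)).tilted fun e => V (update (update x j a) i e)) =
        siteLaw (perturbedTorusSpec W β) i (update x j a) :=
      (siteLaw_perturbedTorusSpec_eq_tilted_haar W β i (update x j a)).symm
    rw [e1, e2]
    have hωη : ∀ z, z ≠ j → x z = update x j a z := fun z hz => by rw [update_of_ne hz]
    have key := abs_integral_siteLaw_sub_le hd hN hL hK hR hmod w hij.symm hωη ψ Lψ hψm ⟨Mψ, hψb⟩ hL0 hψL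
    rw [update_self] at key
    refine key.trans ?_
    have hd0 : 0 ≤ suFrobDist (x j) a := suFrobDist_nonneg _ _
    have hent : K * Real.exp (w.oscLoad 0 i) * (1 + 2 * Real.sqrt N * w.selfLipLoad 0 i) * (|β| / N) * tInfluence i j +
        Real.sqrt N * w.crossLip 0 i j ≤ cm i j := by
      simp only [hcm, hA]
      refine add_le_add ?_ le_rfl
      have h1 : K * Real.exp (w.oscLoad 0 i) * (1 + 2 * Real.sqrt N * w.selfLipLoad 0 i) * (|β| / N) ≤
          K * Real.exp ε₀ * (1 + 2 * Real.sqrt N * ε₁) * (|β| / N) := by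
        have := Real.exp_le_exp.2 (ha i)
        have := hs i
        have := selfLipLoad_nonneg w 0 i
        have : (0 : ℝ) ≤ Real.sqrt N := Real.sqrt_nonneg _
        have : 0 ≤ Real.exp (w.oscLoad 0 i) := (Real.exp_pos _).le
        gcongr
      have h2 : (tInfluence i j : ℝ) ≤ jointPlaq i j := by exact_mod_cast tInfluence_le_jointPlaq hL i j
      exact mul_le_mul h1 h2 (Nat.cast_nonneg _) hA0
    calc _ = (K * Real.exp (w.oscLoad 0 i) * (1 + 2 * Real.sqrt N * w.selfLipLoad 0 i) * (|β| / N) * tInfluence i j +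
          Real.sqrt N * w.crossLip 0 i j) * (Lψ * suFrobDist (x j) a) := by ring
      _ ≤ cm i j * (Lψ * suFrobDist (x j) a) := mul_le_mul_of_nonneg_right hent (mul_nonneg hL0 hd0)
      _ = Lψ * cm i j * suFrobDist (x j) a := by ring
  -- the abstract theorem
  have key := HeatBath.variance_le_of_kr (ι := Edge d L) (haarProbability (SUN N)) hVm hB₁ suFrobDist hdc suFrobDist_self
    suFrobDist_nonneg suFrobDist_comm hdtri hdsep suFrobDist_le cm hκ₀ (by linarith) hcsum hKR hF hM
  rw [perturbedMeasure_eq_tilted]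
  simpa only [hV] using key

/-- ★★ **`SU(2)`, `d = 4` (quarter modulus `OneLinkKRModulus 2 R 1`): THE HEAT-BATH POINCARÉ INEQUALITY UNIFORMLY ON THE TORUS BALL**, tree coupling `β_W/2`,
`0 ≤ β_W ≤ 2/3`: for a member with per-link loads `a ≤ ε₀`, `ℓ_s ≤ ε₁`, column cross load `≤ ε₂` and `c := (9β_W/2) e^{ε₀}(1 + 2√2 ε₁) + √2 ε₂ < 1`,
`Var_{μ_{β,W,L}}(F) ≤ (2(1 − c))⁻¹ ∑_ℓ ∫∫ (F − F∘[ℓ ↦ g])² dν^W_ℓ dμ_{β,W,L}` on every torus of side `≥ 2`. [folklore] -/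
theorem su2_heatBathPoincare_onBall {βW : ℝ} (h0 : 0 ≤ βW) (h23 : βW ≤ 2 / 3) (hL : 1 < L) {W : Perturbation 4 L 2}
    (w : LoadWitness W) {ε₀ ε₁ ε₂ c : ℝ} (ha : ∀ e, w.oscLoad 0 e ≤ ε₀) (hs : ∀ e, w.selfLipLoad 0 e ≤ ε₁)
    (hcol : ∀ y, ∑ e ∈ univ.erase y, w.crossLip 0 e y ≤ ε₂)
    (hc : 9 * βW / 2 * Real.exp ε₀ * (1 + 2 * Real.sqrt 2 * ε₁) + Real.sqrt 2 * ε₂ ≤ c) (hc1 : c < 1)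
    (F : GaugeConfig 4 L (SUN 2) → ℝ) (hF : Measurable F) (hFb : ∃ M : ℝ, ∀ U, |F U| ≤ M) :
    variance F (W.perturbedMeasure (fundamentalRep (Fin 2)) (βW / 2)) ≤
      (2 * (1 - c))⁻¹ * ∑ ℓ : Edge 4 L, ∫ U, ∫ g, (F U - F (update U ℓ g)) ^ 2
        ∂((haarProbability (SUN 2)).tilted fun g' =>
            torusLogWeight (wilsonPlaqWeight 2 (βW / 2)) (update U ℓ g') - W.total (update U ℓ g'))
        ∂(W.perturbedMeasure (fundamentalRep (Fin 2)) (βW / 2)) := by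
  have habs : |βW / 2| / ((2 : ℕ) : ℝ) = βW / 4 := by rw [abs_of_nonneg (by positivity)]; push_cast; ring
  refine heatBathPoincare_onBall (d := 4) (N := 2) (by norm_num) (by norm_num) hL (β := βW / 2) zero_le_one (R := 3 * βW / 2)
    (by rw [habs]; push_cast; linarith) (SlabAreaLawDimensions.su2_oneLinkKRModulus_of_le_one (by linarith)) w ha hs hcol ?_ hc1 F hF hFb
  rw [habs]; push_cast
  nlinarith [Real.exp_pos ε₀, Real.sqrt_nonneg (2 : ℝ), hc,
    mul_nonneg (Real.exp_pos ε₀).le (Real.sqrt_nonneg (2 : ℝ))]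

/-- ★★ **THE SPRINT LOADS, EVERY `0 ≤ β_W ≤ 1/8`**: for `SU(2)`, `d = 4`, every member with per-link loads `(a, ℓ_s, column Λ) ≤ (1/100, 1/500, 1/500)` and
every torus of side `≥ 2`: `Var_{μ_{β,W,L}}(F) ≤ (5/4) ∑_ℓ ∫∫ (F − F∘[ℓ ↦ g])² dν^W_ℓ dμ_{β,W,L}` — heat-bath spectral gap `≥ 2/5` uniformly on this ball
and in the volume (`c ≤ (9/16)(100/99)(1 + 3/500) + 3/1000 ≤ 3/5`). [folklore] -/
theorem su2_heatBathPoincare_onBall_oneEighth {βW : ℝ} (h0 : 0 ≤ βW) (h8 : βW ≤ 1 / 8) (hL : 1 < L) {W : Perturbation 4 L 2}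
    (w : LoadWitness W) (ha : ∀ e, w.oscLoad 0 e ≤ 1 / 100) (hs : ∀ e, w.selfLipLoad 0 e ≤ 1 / 500)
    (hcol : ∀ y, ∑ e ∈ univ.erase y, w.crossLip 0 e y ≤ 1 / 500)
    (F : GaugeConfig 4 L (SUN 2) → ℝ) (hF : Measurable F) (hFb : ∃ M : ℝ, ∀ U, |F U| ≤ M) :
    variance F (W.perturbedMeasure (fundamentalRep (Fin 2)) (βW / 2)) ≤
      (5 / 4 : ℝ) * ∑ ℓ : Edge 4 L, ∫ U, ∫ g, (F U - F (update U ℓ g)) ^ 2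
        ∂((haarProbability (SUN 2)).tilted fun g' =>
            torusLogWeight (wilsonPlaqWeight 2 (βW / 2)) (update U ℓ g') - W.total (update U ℓ g'))
        ∂(W.perturbedMeasure (fundamentalRep (Fin 2)) (βW / 2)) := by
  have hexp : Real.exp (1 / 100 : ℝ) ≤ 1 / (1 - 1 / 100) := Real.exp_bound_div_one_sub_of_interval (by norm_num) (by norm_num)
  have hsqrt : Real.sqrt 2 ≤ 3 / 2 := by
    rw [show (3 / 2 : ℝ) = Real.sqrt ((3 / 2) ^ 2) by rw [Real.sqrt_sq (by norm_num)]]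
    exact Real.sqrt_le_sqrt (by norm_num)
  have hc : 9 * βW / 2 * Real.exp (1 / 100 : ℝ) * (1 + 2 * Real.sqrt 2 * (1 / 500)) + Real.sqrt 2 * (1 / 500) ≤ 3 / 5 := by
    nlinarith [Real.exp_pos (1 / 100 : ℝ), Real.sqrt_nonneg (2 : ℝ), mul_nonneg h0 (Real.exp_pos (1 / 100 : ℝ)).le,
      mul_nonneg (mul_nonneg h0 (Real.exp_pos (1 / 100 : ℝ)).le) (Real.sqrt_nonneg (2 : ℝ))]
  have key := su2_heatBathPoincare_onBall h0 (by linarith) hL w ha hs hcol hc (by norm_num) F hF hFb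
  norm_num at key ⊢
  exact key

end Summit.Ventures.YMGap.RobustBall.HeatBathPoincareBall

end
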